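import Summits.AtomisticToContinuum.FouriersLaw.Theorems.OddSectorIrreversibilityResponseDensityDetailedBalanceCore
import Summits.AtomisticToContinuum.FouriersLaw.Theorems.OddSectorIrreversibilityResponseDensityGibbsPairing
import Mathlib.Analysis.Calculus.BumpFunction.SmoothApprox

/-!
# Detailed balance of the equilibrium kernels of the pinned chain (hypothesis `hDUAL`, PROVED)

Helper file for item stmt-AtomisticToContinuum-9144 (`ResponseDensity`, route
`OddSectorIrreversibility`, sub-problem `FouriersLaw` of `AtomisticToContinuum`): the extension of
the `C_c^∞` detailed balance (`…DetailedBalanceCore.lean`) to the weighted observables of the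
conditional reduction. Both baths at `T > 0`, `π = e^{-H/T}`, `Θ(q,p) = (q,-p)`:

* `exists_contDiff_hasCompactSupport_abs_sub_le` — a continuous compactly supported function is a
  uniform limit of `C_c^∞` functions;
* `pinnedChain_detailedBalance_compactSupport` — detailed balance for `F, G ∈ C_c`;
* `pinnedChain_detailedBalance` — **for continuous `F, G` with `|F|, |G| ≤ C e^{ϑH}`, `0 < ϑ`,
  `2ϑ < 1/T`, and `t ≥ 0`:
  `∫ e^{-H/T} G · P_t F dx = ∫ e^{-H/T} (F∘Θ) · P_t(G∘Θ) dx`** (truncation `χ_K ·` and dominated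
  convergence with the bound (3.4)); this is the hypothesis `hDUAL` of
  `responseDensity_conclusion_of_hyps` (`…Assembly.lean`, there with `C²` inputs).

No definitions.
-/

noncomputable section

open MeasureTheory ProbabilityTheory Filter Topology Set Function Metric
open scoped NNReal ENNReal ContDiff

namespace Summit.AtomisticToContinuum.FouriersLaw.Theorems

open Literature.MathematicalPhysics.KineticTheory.HeatConduction
open Literature.Probability.Process Literature.MathematicalPhysics.KineticTheory OscillatorChain

variable {N : ℕ}

/-- **Uniform approximation of `C_c` by `C_c^∞`**: for `F` continuous with compact support and `ε > 0`
there is `F' ∈ C_c^∞` with `|F' - F| ≤ ε` everywhere. -/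
theorem exists_contDiff_hasCompactSupport_abs_sub_le {F : PhaseSpace N → ℝ} (hF : Continuous F)
    (hFc : HasCompactSupport F) {ε : ℝ} (hε : 0 < ε) :
    ∃ F' : PhaseSpace N → ℝ, ContDiff ℝ ∞ F' ∧ HasCompactSupport F' ∧ ∀ x, |F' x - F x| ≤ ε := by
  have hu : UniformContinuous F := hFc.uniformContinuous_of_continuous hF
  obtain ⟨g, hg, hgF⟩ := hu.exists_contDiff_dist_le hε
  -- a smooth cutoff equal to one on the support of `F`
  obtain ⟨RF, hRF⟩ := hFc.isCompact.isBounded.subset_closedBall (0 : PhaseSpace N)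
  set R₁ : ℝ := max RF 1 with hR₁
  have hR₁0 : 0 < R₁ := lt_max_of_lt_right one_pos
  let χ : ContDiffBump (0 : PhaseSpace N) := ⟨R₁, R₁ + 1, hR₁0, by linarith⟩
  have hχ1 : ∀ y ∈ tsupport F, (χ : PhaseSpace N → ℝ) y = 1 := by
    intro y hy
    apply χ.one_of_mem_closedBall
    have := hRF hy
    rw [mem_closedBall] at this ⊢
    exact this.trans (le_max_left _ _)
  have hχF : ∀ y, (χ : PhaseSpace N → ℝ) y * F y = F y := by
    intro y
    by_cases hy : y ∈ tsupport F
    · rw [hχ1 y hy, one_mul]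
    · rw [image_eq_zero_of_notMem_tsupport hy, mul_zero]
  refine ⟨fun y => (χ : PhaseSpace N → ℝ) y * g y, χ.contDiff.mul hg, χ.hasCompactSupport.mul_right, fun x => ?_⟩
  rw [← hχF x, ← mul_sub, abs_mul, abs_of_nonneg (χ.nonneg' x)]
  have h1 := χ.le_one (x := x)
  have h2 : |g x - F x| ≤ ε := by
    have := (hgF x).le; rwa [Real.dist_eq] at this
  calc (χ : PhaseSpace N → ℝ) x * |g x - F x| ≤ 1 * ε := mul_le_mul h1 h2 (abs_nonneg _) zero_le_one
    _ = ε := one_mul ε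

section Extension

variable {ω₂ lam β γ : ℝ} (hω : 0 < ω₂) (hl : 0 ≤ lam) (hβ : 0 ≤ β) (hγ : 0 < γ) (hN : 0 < N)
  {T : ℝ} (hT : 0 < T)
include hω hl hβ hγ hN hT

omit hN hT in
/-- Forecasts of a bounded continuous function: continuity and the bound. -/
theorem pinnedChain_forecast_bounded {f : PhaseSpace N → ℝ} (hf : Continuous f) {C : ℝ} (hC : ∀ y, |f y| ≤ C)
    (t : ℝ≥0) :
    Continuous (fun x => ∫ y, f y ∂((pinnedChain ω₂ lam β γ).transitionKernel N T T t x)) ∧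
      ∀ x, |∫ y, f y ∂((pinnedChain ω₂ lam β γ).transitionKernel N T T t x)| ≤ C := by
  haveI := pinnedChain_isMarkovKernel_transitionKernel hω hl hβ hγ.le N T T t
  have hC' : ∀ y, ‖f y‖ ≤ C := fun y => by rw [Real.norm_eq_abs]; exact hC y
  refine ⟨pinnedChain_continuous_integral_transitionKernel hω hl hβ hγ.le N T T _ hf hC', fun x => ?_⟩
  rw [← Real.norm_eq_abs]
  calc _ ≤ ∫ y, ‖f y‖ ∂((pinnedChain ω₂ lam β γ).transitionKernel N T T t x) := norm_integral_le_integral_norm _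
    _ ≤ ∫ y, C ∂((pinnedChain ω₂ lam β γ).transitionKernel N T T t x) :=
        integral_mono_of_nonneg (Eventually.of_forall fun _ => norm_nonneg _) (integrable_const _)
          (Eventually.of_forall fun y => hC' y)
    _ = C := by simp

omit hN hT in
/-- Forecasts are `ε`-close when the observables are (bounded continuous observables). -/
theorem pinnedChain_abs_forecast_sub_le {f g : PhaseSpace N → ℝ} (hf : Continuous f) (hg : Continuous g)
    {Cf Cg : ℝ} (hCf : ∀ y, |f y| ≤ Cf) (hCg : ∀ y, |g y| ≤ Cg) {ε : ℝ} (hε : ∀ y, |f y - g y| ≤ ε)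
    (t : ℝ≥0) (x : PhaseSpace N) :
    |(∫ y, f y ∂((pinnedChain ω₂ lam β γ).transitionKernel N T T t x)) -
        ∫ y, g y ∂((pinnedChain ω₂ lam β γ).transitionKernel N T T t x)| ≤ ε := by
  haveI := pinnedChain_isMarkovKernel_transitionKernel hω hl hβ hγ.le N T T t
  have hIf : Integrable f ((pinnedChain ω₂ lam β γ).transitionKernel N T T t x) :=
    (integrable_const Cf).mono' hf.aestronglyMeasurable (Eventually.of_forall fun y => (Real.norm_eq_abs _).le.trans (hCf y))
  have hIg : Integrable g ((pinnedChain ω₂ lam β γ).transitionKernel N T T t x) :=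
    (integrable_const Cg).mono' hg.aestronglyMeasurable (Eventually.of_forall fun y => (Real.norm_eq_abs _).le.trans (hCg y))
  rw [← integral_sub hIf hIg, ← Real.norm_eq_abs]
  calc _ ≤ ∫ y, ‖f y - g y‖ ∂((pinnedChain ω₂ lam β γ).transitionKernel N T T t x) := norm_integral_le_integral_norm _
    _ ≤ ∫ y, ε ∂((pinnedChain ω₂ lam β γ).transitionKernel N T T t x) :=
        integral_mono_of_nonneg (Eventually.of_forall fun _ => norm_nonneg _) (integrable_const _)
          (Eventually.of_forall fun y => (Real.norm_eq_abs _).le.trans (hε y))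
    _ = ε := by simp

/-- **Detailed balance for `C_c` observables.** -/
theorem pinnedChain_detailedBalance_compactSupport {F G : PhaseSpace N → ℝ} (hF : Continuous F)
    (hFc : HasCompactSupport F) (hG : Continuous G) (hGc : HasCompactSupport G) (t : ℝ≥0) :
    ∫ x, (pinnedChain ω₂ lam β γ).gibbsDensity N T x * G x *
        (∫ y, F y ∂((pinnedChain ω₂ lam β γ).transitionKernel N T T t x)) =
      ∫ x, (pinnedChain ω₂ lam β γ).gibbsDensity N T x * F (x.1, -x.2) *
        (∫ y, G (y.1, -y.2) ∂((pinnedChain ω₂ lam β γ).transitionKernel N T T t x)) := by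
  set π := (pinnedChain ω₂ lam β γ).gibbsDensity N T with hπ
  have hπc : Continuous π := by
    rw [hπ]; exact Real.continuous_exp.comp (((pinnedChain_contDiff_hamiltonian ω₂ lam β γ N (n := 0)).continuous).neg.div_const T)
  have hπ0 : ∀ x, 0 < π x := fun x => (pinnedChain ω₂ lam β γ).gibbsDensity_pos N T x
  have hIπ : Integrable π := by rw [hπ]; exact pinnedChain_integrable_gibbsDensity hω hl hβ γ N hT
  have hflip : Continuous fun x : PhaseSpace N => ((x.1, -x.2) : PhaseSpace N) := continuous_fst.prodMk continuous_snd.neg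
  obtain ⟨CF, hCF⟩ : ∃ C, ∀ y, ‖F y‖ ≤ C := hF.bounded_above_of_compact_support hFc
  obtain ⟨CG, hCG⟩ : ∃ C, ∀ y, ‖G y‖ ≤ C := hG.bounded_above_of_compact_support hGc
  have hCF' : ∀ y, |F y| ≤ CF := fun y => by rw [← Real.norm_eq_abs]; exact hCF y
  have hCG' : ∀ y, |G y| ≤ CG := fun y => by rw [← Real.norm_eq_abs]; exact hCG y
  have hCF0 : 0 ≤ CF := (norm_nonneg _).trans (hCF 0)
  have hCG0 : 0 ≤ CG := (norm_nonneg _).trans (hCG 0)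
  set Z := ∫ x, π x with hZ
  have hZ0 : 0 ≤ Z := integral_nonneg fun x => (hπ0 x).le
  -- integrability of `π a b` for bounded continuous `a, b`
  have hInt : ∀ {a b : PhaseSpace N → ℝ}, Continuous a → Continuous b → ∀ {Ca Cb : ℝ}, (∀ x, |a x| ≤ Ca) →
      (∀ x, |b x| ≤ Cb) → Integrable (fun x => π x * a x * b x) := by
    intro a b ha hb Ca Cb hCa hCb
    refine (hIπ.mul_const (Ca * Cb)).mono' ((hπc.mul ha).mul hb).aestronglyMeasurable (Eventually.of_forall fun x => ?_)
    rw [Real.norm_eq_abs, abs_mul, abs_mul, abs_of_nonneg (hπ0 x).le, mul_assoc]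
    exact mul_le_mul_of_nonneg_left (mul_le_mul (hCa x) (hCb x) (abs_nonneg _) ((abs_nonneg _).trans (hCa x))) (hπ0 x).le
  -- the difference of both sides is `≤ 2ε((CF+1) + (CG+1)) Z` for every `ε ∈ (0,1]`
  have key : ∀ ε : ℝ, 0 < ε → ε ≤ 1 →
      |(∫ x, π x * G x * ∫ y, F y ∂((pinnedChain ω₂ lam β γ).transitionKernel N T T t x)) -
        ∫ x, π x * F (x.1, -x.2) * ∫ y, G (y.1, -y.2) ∂((pinnedChain ω₂ lam β γ).transitionKernel N T T t x)| ≤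
        ε * (2 * (CF + 1 + (CG + 1)) * Z) := by
    intro ε hε hε1
    obtain ⟨F', hF', hF'c, hF'F⟩ := exists_contDiff_hasCompactSupport_abs_sub_le hF hFc hε
    obtain ⟨G', hG', hG'c, hG'G⟩ := exists_contDiff_hasCompactSupport_abs_sub_le hG hGc hε
    have hcore := pinnedChain_detailedBalance_smooth hω hl hβ hγ hN hT hF' hF'c hG' hG'c t
    have hCF1 : ∀ y, |F' y| ≤ CF + 1 := fun y => by
      have h1 := hF'F y; have h2 := hCF' y
      have := abs_sub_abs_le_abs_sub (F' y) (F y)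
      linarith
    have hCG1 : ∀ y, |G' y| ≤ CG + 1 := fun y => by
      have h1 := hG'G y; have h2 := hCG' y
      have := abs_sub_abs_le_abs_sub (G' y) (G y)
      linarith
    have hG't : Continuous fun y : PhaseSpace N => G' (y.1, -y.2) := continuous_comp_momentumFlip hG'.continuous
    have hGt : Continuous fun y : PhaseSpace N => G (y.1, -y.2) := continuous_comp_momentumFlip hG
    -- the four forecasts
    obtain ⟨hPF, hPFb⟩ := pinnedChain_forecast_bounded hω hl hβ hγ (T := T) hF hCF' t
    obtain ⟨hPF', hPF'b⟩ := pinnedChain_forecast_bounded hω hl hβ hγ (T := T) hF'.continuous hCF1 t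
    obtain ⟨hPG, hPGb⟩ := pinnedChain_forecast_bounded hω hl hβ hγ (T := T) hGt (fun y => hCG' _) t
    obtain ⟨hPG', hPG'b⟩ := pinnedChain_forecast_bounded hω hl hβ hγ (T := T) hG't (fun y => hCG1 _) t
    have hdF := pinnedChain_abs_forecast_sub_le hω hl hβ hγ (T := T) hF hF'.continuous hCF' hCF1
      (fun y => by rw [abs_sub_comm]; exact hF'F y) t
    have hdG := pinnedChain_abs_forecast_sub_le hω hl hβ hγ (T := T) hGt hG't (fun y => hCG' _) (fun y => hCG1 _)
      (fun y => by rw [abs_sub_comm]; exact hG'G _) t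
    -- abbreviations of the four integrals
    set A := ∫ x, π x * G x * ∫ y, F y ∂((pinnedChain ω₂ lam β γ).transitionKernel N T T t x) with hA
    set A' := ∫ x, π x * G' x * ∫ y, F' y ∂((pinnedChain ω₂ lam β γ).transitionKernel N T T t x) with hA'
    set B := ∫ x, π x * F (x.1, -x.2) * ∫ y, G (y.1, -y.2) ∂((pinnedChain ω₂ lam β γ).transitionKernel N T T t x) with hB
    set B' := ∫ x, π x * F' (x.1, -x.2) * ∫ y, G' (y.1, -y.2) ∂((pinnedChain ω₂ lam β γ).transitionKernel N T T t x) with hB'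
    have hAA' : |A - A'| ≤ ε * ((CG + (CF + 1)) * Z) := by
      -- `A - A' = ∫ π G (P F - P F') + ∫ π (G - G') P F'`
      have i1 := hInt hG hPF hCG' hPFb
      have i2 := hInt hG'.continuous hPF' hCG1 hPF'b
      have i3 := hInt hG hPF' hCG' hPF'b
      have e : A - A' = (∫ x, π x * G x * ∫ y, F y ∂((pinnedChain ω₂ lam β γ).transitionKernel N T T t x)) -
          (∫ x, π x * G x * ∫ y, F' y ∂((pinnedChain ω₂ lam β γ).transitionKernel N T T t x)) +
          ((∫ x, π x * G x * ∫ y, F' y ∂((pinnedChain ω₂ lam β γ).transitionKernel N T T t x)) -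
            ∫ x, π x * G' x * ∫ y, F' y ∂((pinnedChain ω₂ lam β γ).transitionKernel N T T t x)) := by
        rw [hA, hA']; ring
      rw [e, ← integral_sub i1 i3, ← integral_sub i3 i2]
      have b1 : |∫ x, (π x * G x * ∫ y, F y ∂((pinnedChain ω₂ lam β γ).transitionKernel N T T t x)) -
          π x * G x * ∫ y, F' y ∂((pinnedChain ω₂ lam β γ).transitionKernel N T T t x)| ≤ ε * (CG * Z) := by
        rw [← Real.norm_eq_abs]
        refine (norm_integral_le_of_norm_le (hIπ.mul_const (CG * ε)) (Eventually.of_forall fun x => ?_)).trans (le_of_eq ?_)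
        · rw [← mul_sub, Real.norm_eq_abs, abs_mul, abs_mul, abs_of_nonneg (hπ0 x).le, mul_assoc]
          exact mul_le_mul_of_nonneg_left (mul_le_mul (hCG' x) (hdF x) (abs_nonneg _) hCG0) (hπ0 x).le
        · rw [integral_mul_const, hZ]; ring
      have b2 : |∫ x, (π x * G x * ∫ y, F' y ∂((pinnedChain ω₂ lam β γ).transitionKernel N T T t x)) -
          π x * G' x * ∫ y, F' y ∂((pinnedChain ω₂ lam β γ).transitionKernel N T T t x)| ≤ ε * ((CF + 1) * Z) := by
        rw [← Real.norm_eq_abs]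
        refine (norm_integral_le_of_norm_le (hIπ.mul_const (ε * (CF + 1))) (Eventually.of_forall fun x => ?_)).trans (le_of_eq ?_)
        · rw [show π x * G x * (∫ y, F' y ∂((pinnedChain ω₂ lam β γ).transitionKernel N T T t x)) -
              π x * G' x * (∫ y, F' y ∂((pinnedChain ω₂ lam β γ).transitionKernel N T T t x)) =
              π x * ((G x - G' x) * ∫ y, F' y ∂((pinnedChain ω₂ lam β γ).transitionKernel N T T t x)) by ring,
            Real.norm_eq_abs, abs_mul, abs_of_nonneg (hπ0 x).le, abs_mul]
          refine mul_le_mul_of_nonneg_left (mul_le_mul ?_ (hPF'b x) (abs_nonneg _) hε.le) (hπ0 x).le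
          rw [abs_sub_comm]; exact hG'G x
        · rw [integral_mul_const, hZ]; ring
      calc _ ≤ _ := abs_add_le _ _
        _ ≤ ε * (CG * Z) + ε * ((CF + 1) * Z) := add_le_add b1 b2
        _ = _ := by ring
    have hBB' : |B - B'| ≤ ε * ((CG + (CF + 1)) * Z) := by
      have hFt : Continuous fun y : PhaseSpace N => F (y.1, -y.2) := continuous_comp_momentumFlip hF
      have hF't : Continuous fun y : PhaseSpace N => F' (y.1, -y.2) := continuous_comp_momentumFlip hF'.continuous
      have i1 := hInt hFt hPG (fun y => hCF' _) hPGb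
      have i2 := hInt hF't hPG' (fun y => hCF1 _) hPG'b
      have i3 := hInt hF't hPG (fun y => hCF1 _) hPGb
      have e : B - B' = (B - ∫ x, π x * F' (x.1, -x.2) * ∫ y, G (y.1, -y.2) ∂((pinnedChain ω₂ lam β γ).transitionKernel N T T t x)) +
          ((∫ x, π x * F' (x.1, -x.2) * ∫ y, G (y.1, -y.2) ∂((pinnedChain ω₂ lam β γ).transitionKernel N T T t x)) - B') := by ring
      rw [e, hB, hB', ← integral_sub i1 i3, ← integral_sub i3 i2]
      have b1 : |∫ x, (π x * F (x.1, -x.2) * ∫ y, G (y.1, -y.2) ∂((pinnedChain ω₂ lam β γ).transitionKernel N T T t x)) -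
          π x * F' (x.1, -x.2) * ∫ y, G (y.1, -y.2) ∂((pinnedChain ω₂ lam β γ).transitionKernel N T T t x)| ≤ ε * (CG * Z) := by
        rw [← Real.norm_eq_abs]
        refine (norm_integral_le_of_norm_le (hIπ.mul_const (ε * CG)) (Eventually.of_forall fun x => ?_)).trans (le_of_eq ?_)
        · rw [show π x * F (x.1, -x.2) * (∫ y, G (y.1, -y.2) ∂((pinnedChain ω₂ lam β γ).transitionKernel N T T t x)) -
              π x * F' (x.1, -x.2) * (∫ y, G (y.1, -y.2) ∂((pinnedChain ω₂ lam β γ).transitionKernel N T T t x)) =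
              π x * ((F (x.1, -x.2) - F' (x.1, -x.2)) * ∫ y, G (y.1, -y.2) ∂((pinnedChain ω₂ lam β γ).transitionKernel N T T t x)) by ring,
            Real.norm_eq_abs, abs_mul, abs_of_nonneg (hπ0 x).le, abs_mul]
          refine mul_le_mul_of_nonneg_left (mul_le_mul ?_ (hPGb x) (abs_nonneg _) hε.le) (hπ0 x).le
          rw [abs_sub_comm]; exact hF'F _
        · rw [integral_mul_const, hZ]; ring
      have b2 : |∫ x, (π x * F' (x.1, -x.2) * ∫ y, G (y.1, -y.2) ∂((pinnedChain ω₂ lam β γ).transitionKernel N T T t x)) -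
          π x * F' (x.1, -x.2) * ∫ y, G' (y.1, -y.2) ∂((pinnedChain ω₂ lam β γ).transitionKernel N T T t x)| ≤ ε * ((CF + 1) * Z) := by
        rw [← Real.norm_eq_abs]
        refine (norm_integral_le_of_norm_le (hIπ.mul_const ((CF + 1) * ε)) (Eventually.of_forall fun x => ?_)).trans (le_of_eq ?_)
        · rw [← mul_sub, Real.norm_eq_abs, abs_mul, abs_mul, abs_of_nonneg (hπ0 x).le, mul_assoc]
          exact mul_le_mul_of_nonneg_left (mul_le_mul (hCF1 _) (hdG x) (abs_nonneg _) (by linarith)) (hπ0 x).le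
        · rw [integral_mul_const, hZ]; ring
      calc _ ≤ _ := abs_add_le _ _
        _ ≤ ε * (CG * Z) + ε * ((CF + 1) * Z) := add_le_add b1 b2
        _ = _ := by ring
    have hA'B' : A' = B' := hcore
    calc |A - B| = |(A - A') - (B - B')| := by rw [hA'B']; ring_nf
      _ ≤ |A - A'| + |B - B'| := abs_sub _ _
      _ ≤ ε * ((CG + (CF + 1)) * Z) + ε * ((CG + (CF + 1)) * Z) := add_le_add hAA' hBB'
      _ ≤ ε * (2 * (CF + 1 + (CG + 1)) * Z) := by nlinarith
  have h0 : |(∫ x, π x * G x * ∫ y, F y ∂((pinnedChain ω₂ lam β γ).transitionKernel N T T t x)) -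
      ∫ x, π x * F (x.1, -x.2) * ∫ y, G (y.1, -y.2) ∂((pinnedChain ω₂ lam β γ).transitionKernel N T T t x)| ≤ 0 := by
    refine le_of_forall_pos_le_add fun ε hε => ?_
    rw [zero_add]
    set M := 2 * (CF + 1 + (CG + 1)) * Z with hM
    have hM0 : 0 ≤ M := by rw [hM]; exact mul_nonneg (by positivity) hZ0
    have h := key (min 1 (ε / (M + 1))) (lt_min one_pos (div_pos hε (by positivity))) (min_le_left _ _)
    refine h.trans ?_
    calc min 1 (ε / (M + 1)) * M ≤ ε / (M + 1) * M := mul_le_mul_of_nonneg_right (min_le_right _ _) hM0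
      _ ≤ ε := by
          rw [div_mul_eq_mul_div, div_le_iff₀ (by positivity)]
          nlinarith
  have := abs_nonpos_iff.1 h0
  linarith

/-- **Detailed balance of the equilibrium kernels** (hypothesis `hDUAL`, PROVED): for continuous
`F, G` with `|F| ≤ C_F e^{ϑH}`, `|G| ≤ C_G e^{ϑH}` (`0 < ϑ`, `2ϑ < 1/T`) and `t ≥ 0`,
`∫ e^{-H/T} G · P_t F dx = ∫ e^{-H/T} (F∘Θ) · P_t(G∘Θ) dx`. -/
theorem pinnedChain_detailedBalance {ϑ : ℝ} (hϑ : 0 < ϑ) (h2ϑ : 2 * ϑ < 1 / T) {F G : PhaseSpace N → ℝ}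
    (hF : Continuous F) (hG : Continuous G) {CF CG : ℝ}
    (hFb : ∀ y, |F y| ≤ CF * Real.exp (ϑ * (pinnedChain ω₂ lam β γ).hamiltonian N y))
    (hGb : ∀ y, |G y| ≤ CG * Real.exp (ϑ * (pinnedChain ω₂ lam β γ).hamiltonian N y)) (t : ℝ≥0) :
    ∫ x, Real.exp (-1 / T * (pinnedChain ω₂ lam β γ).hamiltonian N x) * G x *
        (∫ y, F y ∂((pinnedChain ω₂ lam β γ).transitionKernel N T T t x)) =
      ∫ x, Real.exp (-1 / T * (pinnedChain ω₂ lam β γ).hamiltonian N x) * F (x.1, -x.2) *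
        (∫ y, G (y.1, -y.2) ∂((pinnedChain ω₂ lam β γ).transitionKernel N T T t x)) := by
  haveI := pinnedChain_isMarkovKernel_transitionKernel hω hl hβ hγ.le N T T t
  have hϑT : ϑ < 1 / max T T := by
    rw [max_self]
    have : ϑ < 2 * ϑ := by linarith
    exact this.trans h2ϑ
  set Hm := (pinnedChain ω₂ lam β γ).hamiltonian N with hHm
  have hHc : Continuous Hm := (pinnedChain_contDiff_hamiltonian ω₂ lam β γ N (n := 0)).continuous
  have hHΘ : ∀ x : PhaseSpace N, Hm (x.1, -x.2) = Hm x := fun x => (pinnedChain ω₂ lam β γ).hamiltonian_neg_momentum N x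
  have hsc : Continuous smoothCutoff := (contDiff_smoothCutoff (n := 0)).continuous
  have hCF0 : 0 ≤ CF := by
    have := (abs_nonneg _).trans (hFb 0); exact nonneg_of_mul_nonneg_left this (Real.exp_pos _)
  have hCG0 : 0 ≤ CG := by
    have := (abs_nonneg _).trans (hGb 0); exact nonneg_of_mul_nonneg_left this (Real.exp_pos _)
  have hGt : Continuous fun y : PhaseSpace N => G (y.1, -y.2) := continuous_comp_momentumFlip hG
  have hGtb : ∀ y : PhaseSpace N, |G (y.1, -y.2)| ≤ CG * Real.exp (ϑ * Hm y) := fun y => by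
    have := hGb (y.1, -y.2); rwa [hHΘ] at this
  -- the weight `e^{-H/T} e^{2ϑH}` is integrable
  have hc : 0 < 1 / T - 2 * ϑ := by linarith
  have hIw : Integrable fun x : PhaseSpace N => Real.exp (-1 / T * Hm x) * Real.exp (ϑ * Hm x) * Real.exp (ϑ * Hm x) := by
    have h := pinnedChain_integrable_exp_neg_mul_hamiltonian hω hl hβ γ N hc
    refine h.congr (Eventually.of_forall fun x => ?_)
    simp only [hHm]
    rw [← Real.exp_add, ← Real.exp_add]; congr 1; ring
  -- the truncations
  set χ : ℕ → PhaseSpace N → ℝ := fun n x => smoothCutoff (Hm x / (n + 1)) with hχ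
  have hχc : ∀ n, Continuous (χ n) := fun n => hsc.comp (hHc.div_const _)
  have hχs : ∀ n, HasCompactSupport (χ n) := fun n =>
    pinnedChain_hasCompactSupport_cutoff hω hl hβ N γ (by positivity : (0:ℝ) < n + 1)
  have hχ1 : ∀ n x, |χ n x| ≤ 1 := fun n x => by
    rw [abs_of_nonneg (smoothCutoff_nonneg _)]; exact smoothCutoff_le_one _
  have hχΘ : ∀ n (x : PhaseSpace N), χ n (x.1, -x.2) = χ n x := fun n x => by simp only [hχ, hHΘ]
  have hχev : ∀ x, ∀ᶠ n : ℕ in atTop, χ n x = 1 := by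
    intro x
    obtain ⟨n₀, hn₀⟩ := exists_nat_ge (Hm x)
    filter_upwards [eventually_ge_atTop n₀] with n hn
    apply smoothCutoff_of_le_one
    rw [div_le_one (by positivity)]
    have : (n₀ : ℝ) ≤ n := by exact_mod_cast hn
    linarith
  -- detailed balance for the truncations
  have hn : ∀ n : ℕ, ∫ x, (pinnedChain ω₂ lam β γ).gibbsDensity N T x * (χ n x * G x) *
      (∫ y, χ n y * F y ∂((pinnedChain ω₂ lam β γ).transitionKernel N T T t x)) =
      ∫ x, (pinnedChain ω₂ lam β γ).gibbsDensity N T x * (χ n (x.1, -x.2) * F (x.1, -x.2)) *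
        (∫ y, χ n (y.1, -y.2) * G (y.1, -y.2) ∂((pinnedChain ω₂ lam β γ).transitionKernel N T T t x)) :=
    fun n => pinnedChain_detailedBalance_compactSupport hω hl hβ hγ hN hT ((hχc n).mul hF) ((hχs n).mul_right)
      ((hχc n).mul hG) ((hχs n).mul_right) t
  have hπe : ∀ x, (pinnedChain ω₂ lam β γ).gibbsDensity N T x = Real.exp (-1 / T * Hm x) := fun x => by
    simp only [OscillatorChain.gibbsDensity, hHm]; congr 1; ring
  simp only [hπe, hχΘ] at hn
  -- the left-hand sides converge
  have hL : Tendsto (fun n : ℕ => ∫ x, Real.exp (-1 / T * Hm x) * (χ n x * G x) *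
      (∫ y, χ n y * F y ∂((pinnedChain ω₂ lam β γ).transitionKernel N T T t x))) atTop
      (𝓝 (∫ x, Real.exp (-1 / T * Hm x) * G x * ∫ y, F y ∂((pinnedChain ω₂ lam β γ).transitionKernel N T T t x))) := by
    refine tendsto_integral_of_dominated_convergence
      (fun x => CG * (CF * Real.exp (ϑ * γ * (T + T) * t)) * (Real.exp (-1 / T * Hm x) * Real.exp (ϑ * Hm x) * Real.exp (ϑ * Hm x)))
      (fun n => ?_) (hIw.const_mul _) (fun n => Eventually.of_forall fun x => ?_) (Eventually.of_forall fun x => ?_)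
    · obtain ⟨Cn, hCn⟩ : ∃ C, ∀ y, ‖χ n y * F y‖ ≤ C := ((hχc n).mul hF).bounded_above_of_compact_support (hχs n).mul_right
      exact (((Real.continuous_exp.comp (continuous_const.mul hHc)).mul ((hχc n).mul hG)).mul
        (pinnedChain_continuous_integral_transitionKernel hω hl hβ hγ.le N T T _ ((hχc n).mul hF) hCn)).aestronglyMeasurable
    · have hP := pinnedChain_abs_integral_kernel_le hω hl hβ hγ hN hT hT hϑ hϑT (φ := F) (C := CF) hFb t x (hχ1 n)
      rw [Real.norm_eq_abs, abs_mul, abs_mul, abs_of_nonneg (Real.exp_pos _).le, abs_mul]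
      have h1 : |χ n x| * |G x| ≤ CG * Real.exp (ϑ * Hm x) := by
        calc _ ≤ 1 * |G x| := mul_le_mul_of_nonneg_right (hχ1 n x) (abs_nonneg _)
          _ ≤ _ := by rw [one_mul]; exact hGb x
      have h2 := mul_le_mul h1 hP (abs_nonneg _) (by positivity)
      calc Real.exp (-1 / T * Hm x) * (|χ n x| * |G x|) *
            |∫ y, χ n y * F y ∂((pinnedChain ω₂ lam β γ).transitionKernel N T T t x)| =
            Real.exp (-1 / T * Hm x) * ((|χ n x| * |G x|) *
              |∫ y, χ n y * F y ∂((pinnedChain ω₂ lam β γ).transitionKernel N T T t x)|) := by ring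
        _ ≤ Real.exp (-1 / T * Hm x) * (CG * Real.exp (ϑ * Hm x) * (CF * (Real.exp (ϑ * γ * (T + T) * ↑t) * Real.exp (ϑ * Hm x)))) :=
            mul_le_mul_of_nonneg_left h2 (Real.exp_pos _).le
        _ = _ := by ring
    · have h1 := pinnedChain_tendsto_integral_cutoff_kernel hω hl hβ hγ hN hT hT hϑ hϑT hF hFb t x
      have h2 : Tendsto (fun n : ℕ => Real.exp (-1 / T * Hm x) * (χ n x * G x)) atTop (𝓝 (Real.exp (-1 / T * Hm x) * G x)) :=
        tendsto_const_nhds.congr' ((hχev x).mono fun n hn => by simp only [hn, one_mul])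
      exact h2.mul h1
  -- the right-hand sides converge
  have hR : Tendsto (fun n : ℕ => ∫ x, Real.exp (-1 / T * Hm x) * (χ n x * F (x.1, -x.2)) *
      (∫ y, χ n y * G (y.1, -y.2) ∂((pinnedChain ω₂ lam β γ).transitionKernel N T T t x))) atTop
      (𝓝 (∫ x, Real.exp (-1 / T * Hm x) * F (x.1, -x.2) *
        ∫ y, G (y.1, -y.2) ∂((pinnedChain ω₂ lam β γ).transitionKernel N T T t x))) := by
    have hFt : Continuous fun y : PhaseSpace N => F (y.1, -y.2) := continuous_comp_momentumFlip hF
    refine tendsto_integral_of_dominated_convergence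
      (fun x => CF * (CG * Real.exp (ϑ * γ * (T + T) * t)) * (Real.exp (-1 / T * Hm x) * Real.exp (ϑ * Hm x) * Real.exp (ϑ * Hm x)))
      (fun n => ?_) (hIw.const_mul _) (fun n => Eventually.of_forall fun x => ?_) (Eventually.of_forall fun x => ?_)
    · obtain ⟨Cn, hCn⟩ : ∃ C, ∀ y, ‖χ n y * G (y.1, -y.2)‖ ≤ C := ((hχc n).mul hGt).bounded_above_of_compact_support (hχs n).mul_right
      exact (((Real.continuous_exp.comp (continuous_const.mul hHc)).mul ((hχc n).mul hFt)).mul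
        (pinnedChain_continuous_integral_transitionKernel hω hl hβ hγ.le N T T _ ((hχc n).mul hGt) hCn)).aestronglyMeasurable
    · have hP := pinnedChain_abs_integral_kernel_le hω hl hβ hγ hN hT hT hϑ hϑT (φ := fun y => G (y.1, -y.2)) (C := CG) hGtb t x (hχ1 n)
      rw [Real.norm_eq_abs, abs_mul, abs_mul, abs_of_nonneg (Real.exp_pos _).le, abs_mul]
      have h1 : |χ n x| * |F (x.1, -x.2)| ≤ CF * Real.exp (ϑ * Hm x) := by
        calc _ ≤ 1 * |F (x.1, -x.2)| := mul_le_mul_of_nonneg_right (hχ1 n x) (abs_nonneg _)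
          _ ≤ _ := by rw [one_mul]; have := hFb (x.1, -x.2); rwa [hHΘ] at this
      have h2 := mul_le_mul h1 hP (abs_nonneg _) (by positivity)
      calc Real.exp (-1 / T * Hm x) * (|χ n x| * |F (x.1, -x.2)|) *
            |∫ y, χ n y * G (y.1, -y.2) ∂((pinnedChain ω₂ lam β γ).transitionKernel N T T t x)| =
            Real.exp (-1 / T * Hm x) * ((|χ n x| * |F (x.1, -x.2)|) *
              |∫ y, χ n y * G (y.1, -y.2) ∂((pinnedChain ω₂ lam β γ).transitionKernel N T T t x)|) := by ring
        _ ≤ Real.exp (-1 / T * Hm x) * (CF * Real.exp (ϑ * Hm x) * (CG * (Real.exp (ϑ * γ * (T + T) * ↑t) * Real.exp (ϑ * Hm x)))) :=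
            mul_le_mul_of_nonneg_left h2 (Real.exp_pos _).le
        _ = _ := by ring
    · have h1 := pinnedChain_tendsto_integral_cutoff_kernel hω hl hβ hγ hN hT hT hϑ hϑT hGt hGtb t x
      have h2 : Tendsto (fun n : ℕ => Real.exp (-1 / T * Hm x) * (χ n x * F (x.1, -x.2))) atTop
          (𝓝 (Real.exp (-1 / T * Hm x) * F (x.1, -x.2))) :=
        tendsto_const_nhds.congr' ((hχev x).mono fun n hn => by simp only [hn, one_mul])
      exact h2.mul h1
  exact tendsto_nhds_unique (hL.congr hn) hR

/-- **The hypothesis `hDUAL` of the conditional reduction, discharged** (in the shape used by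
`responseDensity_conclusion_of_hyps`, with `C²` inputs). -/
theorem pinnedChain_hDUAL {ϑ : ℝ} (hϑ : 0 < ϑ) (h2ϑ : 2 * ϑ < 1 / T) :
    ∀ (t : ℝ≥0) (F G : PhaseSpace N → ℝ) (CF CG : ℝ), ContDiff ℝ 2 F → ContDiff ℝ 2 G →
      (∀ y, |F y| ≤ CF * Real.exp (ϑ * (pinnedChain ω₂ lam β γ).hamiltonian N y)) →
      (∀ y, |G y| ≤ CG * Real.exp (ϑ * (pinnedChain ω₂ lam β γ).hamiltonian N y)) →
      ∫ x, Real.exp (-1 / T * (pinnedChain ω₂ lam β γ).hamiltonian N x) * G x *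
          (∫ y, F y ∂((pinnedChain ω₂ lam β γ).transitionKernel N T T t x)) =
        ∫ x, Real.exp (-1 / T * (pinnedChain ω₂ lam β γ).hamiltonian N x) * F (x.1, -x.2) *
          (∫ y, G (y.1, -y.2) ∂((pinnedChain ω₂ lam β γ).transitionKernel N T T t x)) :=
  fun t _ _ _ _ hF hG hFb hGb => pinnedChain_detailedBalance hω hl hβ hγ hN hT hϑ h2ϑ hF.continuous hG.continuous hFb hGb t

end Extension

end Summit.AtomisticToContinuum.FouriersLaw.Theorems

end
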